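import Mathlib.MeasureTheory.Constructions.HaarToSphere
import Literature.Analysis.FluidPDE.HardSphereDynamics
import HarnessLib

/-!
# The η-freedom control system of `N` hard spheres

Topic `Literature/Analysis/FluidPDE` (definition item `defn-ControlledHardSphereTrajectory`,
posited object of the crux `LaneReachability` of route SinaiSteering, summit
AtomisticToContinuum/HydrodynamicLimit). Over the hard-sphere prelude
(`HardSpherePhaseSpace`: `Geometry`, `Config`, `hardSphereDomain`, `contactSet`, `freeFlight`,
`reflectVel`, `collidePair`, `IsIncoming`/`IsOutgoing`; `HardSphereDynamics`:
`collisionTimes`, `IsHardSphereTrajectory`).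

A **controlled hard-sphere trajectory** moves by free flight in the hard-sphere domain and, at
each (binary, non-grazing) contact of a pair `{i, j}`, jumps by the elastic reflection of the
pair's velocities (`reflectVel`) across a unit vector `n` that need NOT be the contact normal
`ω = (x_i - x_j)/ε`: the realised normals `ν t` are part of the data, the only built-in
requirements being that `n` is a unit vector and that the pair separates afterwards. Any such
jump conserves kinetic energy and momentum (`configEnergy_collidePairWith`,
`configMomentum_collidePairWith`). The **control constraint is set-wise**: a `ControlPolicy`
assigns to (trajectory, time, pair) a set of admissible unit normals, and the policy has
**freedom `η`** if each such set is measurable of normalised surface measure `≥ η` on the unit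
sphere `S^{d-1}` (`Measure.toSphere volume`); a controlled trajectory is **admissible** for the
policy if every realised normal lies in the assigned set. This is the control-of-chaos setting of
Ott–Grebogi–Yorke (PRL 64 (1990) 1196) / Shinbrot–Grebogi–Ott–Yorke (Nature 363 (1993) 411):
small admissible interventions at naturally occurring events; NO existence or reachability claim
is made here (those are the route's statements).

## Contents (namespace `Literature.Analysis.FluidPDE`)

* `collidePairWith i j n z` — positions unchanged, `(v_i, v_j) ↦ reflectVel n (v_i, v_j)`;
  `collidePairWith_sepVec : collidePairWith i j (x_i - x_j) z = collidePair G i j z` (`rfl`),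
  `collidePairWith_smul` (only the line `ℝn` matters), conservation of energy and momentum.
* `IsControlledHardSphereTrajectory G ε N γ ν` — the fields `mem`, `locFinite`,
  `pos_continuous`, `free` of `IsHardSphereTrajectory` verbatim, and `binary`: at a contact time
  a single pair `{i, j}` is in contact, the left limit `z⁻` exists and is incoming, `‖ν t‖ = 1`,
  `γ t = collidePairWith i j (ν t) z⁻` and the pair is outgoing in `γ t`.
* `ControlledHardSphereTrajectory G ε N` — the bundle `(γ, ν, proof)`.
* `ControlPolicy d X N` (`allowed γ t i j : Set (ℝ^d)`), `ControlPolicy.HasFreedom P η`,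
  `ControlPolicy.IsCausal`, `ControlPolicy.Admissible P G ε γ ν`, `ControlPolicy.InCap` (small
  interventions: allowed normals within angle `θ` of the contact line); the reachable set
  `ControlPolicy.Reach P G ε t z₀` (endpoints at time `t` of admissible trajectories from `z₀`),
  the robust form `ControlPolicy.Steers P G ε t z₀ B` (some admissible trajectory from `z₀`
  exists and EVERY one is in `B` at time `t`) and **`SteerableWithFreedom G ε N η t z₀ B`**
  (`∃` STRICTLY CAUSAL policy of freedom `η` that steers) — THE `η`-dependent notion for
  reachability statements (causality is essential: a policy reading the post-jump state `γ t`
  could pin the realised normal with full freedom):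
  existential reachability is freedom-blind (`univPolicy_hasFreedom`,
  `reach_subset_reach_univPolicy`), because the measure-`≥ η` lower bound restricts the
  adversary realising the normal inside the assigned set, never the controller choosing the sets.
* Sanity: the **true policy** `truePolicy G ε` (only the contact normal `±ω/ε` allowed) gives
  back the uncontrolled dynamics — `Admissible (truePolicy G ε) … γ ν → IsHardSphereTrajectory
  G ε N γ` and conversely every hard-sphere trajectory is admissible for it with the realised
  normals `trueNormal` (`isHardSphereTrajectory_iff_exists_admissible_truePolicy`).

## Design notes

The normal `n` and `-n` give the same jump (`collidePairWith_neg`), so policies are really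
policies on lines. Smallness of the interventions (the "cap around `ω`") is carried by the policy
predicate `ControlPolicy.InCap P G ε θ` (aperture `θ` a parameter of the statement using it), not
by the trajectory structure; freedom `η` and aperture `θ` are then jointly constrained by the
statement. The impact-parameter phrasing
(re-positioning the relative offset in the contact disc before a true reflection) is equivalent
for spheres and is not formalised separately. Freedom is measured with Mathlib's
`Measure.toSphere volume` on `S^{d-1} ⊂ ℝ^d`, normalised by its total mass. General geometry and
dimension, as the prelude.

## References

* E. Ott, C. Grebogi, J. A. Yorke, *Controlling chaos*, Phys. Rev. Lett. 64 (1990) 1196;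
  T. Shinbrot, C. Grebogi, E. Ott, J. A. Yorke, *Using small perturbations to control chaos*,
  Nature 363 (1993) 411 (control by small admissible interventions at natural events).
* I. Gallagher, L. Saint-Raymond, B. Texier, *From Newton to Boltzmann* (2013), §1.1, §4.1
  (the uncontrolled dynamics, `IsHardSphereTrajectory`).
-/

open MeasureTheory Set Filter Topology Metric
open scoped ENNReal InnerProductSpace

namespace Literature.Analysis.FluidPDE

noncomputable section

section Kinetic

variable {d : Type*} [Fintype d] {X : Type*} {N : ℕ}

/-! ## Reflection of a pair across an arbitrary normal -/

omit [Fintype d] in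
/-- A sum over `Fin N` is unchanged if the summand changes only at `i ≠ j` with the same
two-term sum there. [folklore] -/
theorem sum_eq_sum_of_pair' {M : Type*} [AddCommMonoid M] {i j : Fin N} (hij : i ≠ j)
    {f g : Fin N → M} (hfg : f i + f j = g i + g j) (h : ∀ k, k ≠ i → k ≠ j → f k = g k) :
    ∑ k, f k = ∑ k, g k := by
  have hj : j ∈ Finset.univ.erase i := Finset.mem_erase.2 ⟨hij.symm, Finset.mem_univ j⟩
  rw [← Finset.add_sum_erase _ _ (Finset.mem_univ i), ← Finset.add_sum_erase _ _ hj,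
    ← Finset.add_sum_erase _ _ (Finset.mem_univ i), ← Finset.add_sum_erase _ _ hj,
    ← add_assoc, ← add_assoc, hfg]
  congr 1
  refine Finset.sum_congr rfl fun k hk => ?_
  simp only [Finset.mem_erase] at hk
  exact h k hk.2.1 hk.1

/-- **Controlled collision of the pair `(i, j)` across the normal `n`**: positions unchanged, the
velocities `(v_i, v_j)` replaced by their elastic reflection `reflectVel n (v_i, v_j)` across the
(unnormalised) direction `n` — the contact normal `x_i - x_j` gives the true collision
`collidePair` (`collidePairWith_sepVec`). [folklore] -/
def collidePairWith (i j : Fin N) (n : EuclideanSpace ℝ d) (z : Config N d X) : Config N d X :=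
  Function.update (Function.update z i ((z i).1, (reflectVel n ((z i).2, (z j).2)).1)) j
    ((z j).1, (reflectVel n ((z i).2, (z j).2)).2)

variable {i j : Fin N}

/-- Across the contact normal the controlled collision is the true one (definitional). [folklore] -/
theorem collidePairWith_sepVec (G : Geometry d X) (i j : Fin N) (z : Config N d X) :
    collidePairWith i j (G.sepVec (z i).1 (z j).1) z = collidePair G i j z :=
  rfl

/-- After the controlled collision, particle `i` has velocity `v_i'` and unchanged position. [folklore] -/
theorem collidePairWith_apply_left (hij : i ≠ j) (n : EuclideanSpace ℝ d) (z : Config N d X) :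
    collidePairWith i j n z i = ((z i).1, (reflectVel n ((z i).2, (z j).2)).1) := by
  simp [collidePairWith, Function.update_of_ne hij]

/-- After the controlled collision, particle `j` has velocity `v_j'` and unchanged position. [folklore] -/
theorem collidePairWith_apply_right (n : EuclideanSpace ℝ d) (z : Config N d X) :
    collidePairWith i j n z j = ((z j).1, (reflectVel n ((z i).2, (z j).2)).2) := by
  simp [collidePairWith]

/-- Particles other than `i, j` are unaffected. [folklore] -/
theorem collidePairWith_apply_of_ne {k : Fin N} (hki : k ≠ i) (hkj : k ≠ j) (n : EuclideanSpace ℝ d)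
    (z : Config N d X) : collidePairWith i j n z k = z k := by
  simp [collidePairWith, Function.update_of_ne hki, Function.update_of_ne hkj]

/-- A controlled collision does not move the particles. [folklore] -/
@[simp] theorem collidePairWith_apply_fst (n : EuclideanSpace ℝ d) (z : Config N d X) (k : Fin N) :
    (collidePairWith i j n z k).1 = (z k).1 := by
  by_cases hkj : k = j
  · subst hkj; rw [collidePairWith_apply_right]
  by_cases hki : k = i
  · subst hki; rw [collidePairWith_apply_left hkj]
  rw [collidePairWith_apply_of_ne hki hkj]

/-- Only the line `ℝ n` matters: `collidePairWith i j (c • n) = collidePairWith i j n` for `c ≠ 0`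
(`reflectVel_smul`). [folklore] -/
theorem collidePairWith_smul {c : ℝ} (hc : c ≠ 0) (n : EuclideanSpace ℝ d) (z : Config N d X) :
    collidePairWith i j (c • n) z = collidePairWith i j n z := by
  simp only [collidePairWith, reflectVel_smul hc]

/-- `n` and `-n` give the same controlled collision. [folklore] -/
theorem collidePairWith_neg (n : EuclideanSpace ℝ d) (z : Config N d X) :
    collidePairWith i j (-n) z = collidePairWith i j n z := by
  rw [← neg_one_smul ℝ n, collidePairWith_smul (by norm_num)]

/-- **A controlled collision conserves the kinetic energy** (the reflection across ANY normal
does, `norm_sq_reflectVel_fst_add_norm_sq_reflectVel_snd`). [folklore] -/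
theorem configEnergy_collidePairWith (hij : i ≠ j) (n : EuclideanSpace ℝ d) (z : Config N d X) :
    configEnergy (collidePairWith i j n z) = configEnergy z := by
  unfold configEnergy
  congr 1
  refine sum_eq_sum_of_pair' hij ?_ fun k hki hkj => by rw [collidePairWith_apply_of_ne hki hkj]
  rw [collidePairWith_apply_left hij, collidePairWith_apply_right]
  exact norm_sq_reflectVel_fst_add_norm_sq_reflectVel_snd _ _

/-- **A controlled collision conserves the total momentum** (`reflectVel_fst_add_reflectVel_snd`). [folklore] -/
theorem configMomentum_collidePairWith (hij : i ≠ j) (n : EuclideanSpace ℝ d) (z : Config N d X) :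
    configMomentum (collidePairWith i j n z) = configMomentum z := by
  unfold configMomentum
  refine sum_eq_sum_of_pair' hij ?_ fun k hki hkj => by rw [collidePairWith_apply_of_ne hki hkj]
  rw [collidePairWith_apply_left hij, collidePairWith_apply_right]
  exact reflectVel_fst_add_reflectVel_snd _ _

/-- Controlled collisions preserve the hard-sphere domain (positions do not move). [folklore] -/
theorem collidePairWith_mem_hardSphereDomain_iff {G : Geometry d X} {ε : ℝ} (n : EuclideanSpace ℝ d)
    (z : Config N d X) : collidePairWith i j n z ∈ hardSphereDomain G N ε ↔ z ∈ hardSphereDomain G N ε := by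
  simp [mem_hardSphereDomain]

/-- The controlled collision of `(j, i)` across `n` equals that of `(i, j)`: the reflection law
is symmetric under exchanging the pair. [folklore] -/
theorem collidePairWith_comm (hij : i ≠ j) (n : EuclideanSpace ℝ d) (z : Config N d X) :
    collidePairWith j i n z = collidePairWith i j n z := by
  have hr : ∀ v w : EuclideanSpace ℝ d, reflectVel n (w, v) = ((reflectVel n (v, w)).2, (reflectVel n (v, w)).1) := by
    intro v w
    simp only [reflectVel, Prod.mk.injEq]
    have : ⟪w - v, n⟫_ℝ = -⟪v - w, n⟫_ℝ := by rw [← inner_neg_left, neg_sub]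
    rw [this, neg_div, neg_smul]
    exact ⟨sub_neg_eq_add _ _, (sub_eq_add_neg _ _).symm⟩
  funext k
  by_cases hki : k = i
  · subst hki
    rw [collidePairWith_apply_right, collidePairWith_apply_left hij, hr]
  by_cases hkj : k = j
  · subst hkj
    rw [collidePairWith_apply_left (Ne.symm hij), collidePairWith_apply_right, hr]
  rw [collidePairWith_apply_of_ne hkj hki, collidePairWith_apply_of_ne hki hkj]

/-- Across a unit contact normal the controlled jump is the true elastic jump: if
`n = ±ε⁻¹ (x_i - x_j)` with the positions of `z` and `ε ≠ 0`, then
`collidePairWith i j n z = collidePair G i j z`. [folklore] -/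
theorem collidePairWith_eq_collidePair_of_mem_truePolicy {G : Geometry d X} {ε : ℝ} (hε : ε ≠ 0)
    {n : EuclideanSpace ℝ d} {z : Config N d X}
    (hn : n = ε⁻¹ • G.sepVec (z i).1 (z j).1 ∨ n = -(ε⁻¹ • G.sepVec (z i).1 (z j).1)) :
    collidePairWith i j n z = collidePair G i j z := by
  rcases hn with rfl | rfl
  · rw [collidePairWith_smul (inv_ne_zero hε), collidePairWith_sepVec]
  · rw [collidePairWith_neg, collidePairWith_smul (inv_ne_zero hε), collidePairWith_sepVec]

/-! ### Live and dead normals -/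

omit [Fintype d] in
/-- The relative velocity after an elastic reflection across `n`:
`v' - w' = (v - w) - 2 (⟪v - w, n⟫ / |n|²) n`. [folklore] -/
theorem reflectVel_fst_sub_snd {E : Type*} [NormedAddCommGroup E] [InnerProductSpace ℝ E] (n : E) (p : E × E) :
    (reflectVel n p).1 - (reflectVel n p).2 = (p.1 - p.2) - (2 * (⟪p.1 - p.2, n⟫_ℝ / ‖n‖ ^ 2)) • n := by
  simp only [reflectVel, mul_smul, two_smul]
  abel

omit [Fintype d] in
/-- The pairing of the post-reflection relative velocity with a direction `ω`:
`⟪ω, v' - w'⟫ = ⟪ω, v - w⟫ - 2 (⟪v - w, n⟫ / |n|²) ⟪ω, n⟫` — the formula deciding whether the pair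
separates after a reflection across `n` (`isOutgoing_collidePairWith_iff`). [folklore] -/
theorem inner_reflectVel_fst_sub_snd_eq {E : Type*} [NormedAddCommGroup E] [InnerProductSpace ℝ E]
    (ω n : E) (p : E × E) :
    ⟪ω, (reflectVel n p).1 - (reflectVel n p).2⟫_ℝ =
      ⟪ω, p.1 - p.2⟫_ℝ - 2 * (⟪p.1 - p.2, n⟫_ℝ / ‖n‖ ^ 2) * ⟪ω, n⟫_ℝ := by
  rw [reflectVel_fst_sub_snd, inner_sub_right, inner_smul_right]

/-- **The pair separates after the controlled collision across `n` iff**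
`0 < ⟪ω, v_i - v_j⟫ - 2 (⟪v_i - v_j, n⟫ / |n|²) ⟪ω, n⟫`, `ω = x_i - x_j`. [folklore] -/
theorem isOutgoing_collidePairWith_iff {G : Geometry d X} (hij : i ≠ j) (n : EuclideanSpace ℝ d) (z : Config N d X) :
    IsOutgoing G (collidePairWith i j n z) i j ↔
      0 < ⟪G.sepVec (z i).1 (z j).1, (z i).2 - (z j).2⟫_ℝ -
        2 * (⟪(z i).2 - (z j).2, n⟫_ℝ / ‖n‖ ^ 2) * ⟪G.sepVec (z i).1 (z j).1, n⟫_ℝ := by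
  unfold IsOutgoing
  rw [collidePairWith_apply_fst, collidePairWith_apply_fst, collidePairWith_apply_left hij,
    collidePairWith_apply_right, inner_reflectVel_fst_sub_snd_eq]

/-- **Dead normals**: from an incoming pair, a reflection across a normal `n` with
`⟪v_i - v_j, n⟫ ⟪x_i - x_j, n⟫ ≥ 0` (an open region of normalised surface measure about `1/2` on
`S^{d-1}`) does NOT make the pair outgoing — no controlled trajectory continues through such a
jump (`IsControlledHardSphereTrajectory.binary` demands `IsOutgoing`). This is why freedom must be
counted among LIVE normals only (`ControlPolicy.WellPosed`): otherwise a controller could pad its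
assigned sets with dead normals and pin the live one. [folklore] -/
theorem not_isOutgoing_collidePairWith_of_dead {G : Geometry d X} (hij : i ≠ j) {n : EuclideanSpace ℝ d}
    {z : Config N d X} (hin : IsIncoming G z i j)
    (hdead : 0 ≤ ⟪(z i).2 - (z j).2, n⟫_ℝ * ⟪G.sepVec (z i).1 (z j).1, n⟫_ℝ) :
    ¬IsOutgoing G (collidePairWith i j n z) i j := by
  rw [isOutgoing_collidePairWith_iff hij, not_lt]
  have h2 : 0 ≤ 2 * (⟪(z i).2 - (z j).2, n⟫_ℝ / ‖n‖ ^ 2) * ⟪G.sepVec (z i).1 (z j).1, n⟫_ℝ := by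
    rw [show 2 * (⟪(z i).2 - (z j).2, n⟫_ℝ / ‖n‖ ^ 2) * ⟪G.sepVec (z i).1 (z j).1, n⟫_ℝ =
      (2 / ‖n‖ ^ 2) * (⟪(z i).2 - (z j).2, n⟫_ℝ * ⟪G.sepVec (z i).1 (z j).1, n⟫_ℝ) by ring]
    exact mul_nonneg (by positivity) hdead
  have h1 : ⟪G.sepVec (z i).1 (z j).1, (z i).2 - (z j).2⟫_ℝ < 0 := hin
  linarith

/-! ## Controlled trajectories -/

section Trajectory

variable [TopologicalSpace X]

/-- **`γ` is a controlled hard-sphere trajectory with realised normals `ν`** (`N` spheres of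
diameter `ε` in the geometry `G`): it stays in the hard-sphere domain, its contact times are
locally finite, positions are continuous, it is free flight on contact-free intervals `(s, t]`
(exactly the fields `mem`, `locFinite`, `pos_continuous`, `free` of `IsHardSphereTrajectory`),
and at a contact time `t` a single pair `{i, j}` is in contact, the left limit `z⁻` exists and is
incoming, and the jump is the reflection of the pair across the UNIT normal `ν t` — not
necessarily the contact normal — after which the pair separates:
`γ t = collidePairWith i j (ν t) z⁻`, `IsOutgoing G (γ t) i j`. The values of `ν` off the
contact times are irrelevant. No control constraint is imposed here (see
`ControlPolicy.Admissible`). [folklore] -/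
structure IsControlledHardSphereTrajectory (G : Geometry d X) (ε : ℝ) (N : ℕ) (γ : ℝ → Config N d X)
    (ν : ℝ → EuclideanSpace ℝ d) : Prop where
  /-- The trajectory stays in the hard-sphere domain `D_ε^N`. -/
  mem : ∀ t, γ t ∈ hardSphereDomain G N ε
  /-- Contact times are locally finite. -/
  locFinite : ∀ a b, (collisionTimes G ε γ ∩ Icc a b).Finite
  /-- Positions are continuous in time. -/
  pos_continuous : ∀ i, Continuous fun t => (γ t i).1
  /-- Free flight on contact-free intervals `(s, t]`. -/
  free : ∀ s t, s ≤ t → (∀ τ ∈ Ioc s t, τ ∉ collisionTimes G ε γ) →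
    γ t = freeFlight G (t - s) (γ s)
  /-- At a contact time a single pair collides, from an incoming left limit, by reflection
  across the unit normal `ν t`, and separates afterwards. -/
  binary : ∀ t (i j : Fin N), i ≠ j → γ t ∈ contactSet G N ε i j →
    (∀ i' j' : Fin N, i' ≠ j' → γ t ∈ contactSet G N ε i' j' →
      ({i', j'} : Finset (Fin N)) = {i, j}) ∧
    ∃ zl, Tendsto γ (𝓝[<] t) (𝓝 zl) ∧ IsIncoming G zl i j ∧ ‖ν t‖ = 1 ∧
      γ t = collidePairWith i j (ν t) zl ∧ IsOutgoing G (γ t) i j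

/-- **A controlled hard-sphere trajectory, bundled**: the curve `γ`, the realised unit normals
`ν` and the proof. [folklore] -/
structure ControlledHardSphereTrajectory (G : Geometry d X) (ε : ℝ) (N : ℕ) where
  /-- the trajectory -/
  traj : ℝ → Config N d X
  /-- the realised normals at the contact times -/
  normal : ℝ → EuclideanSpace ℝ d
  /-- the dynamics -/
  isControlled : IsControlledHardSphereTrajectory G ε N traj normal

/-! ## Control policies, freedom, admissibility, reachable sets -/

variable (d X N) in
/-- **A control policy**: to a trajectory `γ` (its history), a time `t` and an ordered pair
`(i, j)` it assigns the set of admissible normals `allowed γ t i j ⊆ ℝ^d` for a collision of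
`{i, j}` at time `t` (only its unit vectors matter, and `n`, `-n` act identically,
`collidePairWith_neg`). Causality of the dependence on `γ` is the separate predicate `IsCausal`. [folklore] -/
structure ControlPolicy where
  /-- the admissible normals for a collision of `(i, j)` at time `t` along `γ` -/
  allowed : (ℝ → Config N d X) → ℝ → Fin N → Fin N → Set (EuclideanSpace ℝ d)

namespace ControlPolicy

omit [TopologicalSpace X] in
/-- **Freedom `η`** of a policy: every assigned set of normals, traced on the unit sphere
`S^{d-1}`, is measurable and has surface measure at least `η` times the total surface measure
(`Measure.toSphere volume`; "a subset of the sphere of normalised measure `≥ η`"). The condition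
is imposed at all `(γ, t, i, j)`, including `i = j` and non-contact times, where it is idle (a
policy may assign `univ` there). Freedom constrains the ADVERSARY who picks the realised normal
inside the assigned set, not the controller who picks the sets: it matters only for robust
(universally quantified) reachability, `Steers` / `SteerableWithFreedom`, never for the
existential `Reach` (`reach_subset_reach_univPolicy`, `univPolicy_hasFreedom`); and it is a
freedom only together with `WellPosed` (all allowed unit normals live), since dead normals carry
no admissible continuation. [folklore] -/
def HasFreedom (P : ControlPolicy d X N) (η : ℝ) : Prop :=
  ∀ γ t i j, MeasurableSet ((↑) ⁻¹' P.allowed γ t i j : Set (sphere (0 : EuclideanSpace ℝ d) 1)) ∧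
    ENNReal.ofReal η * (volume : Measure (EuclideanSpace ℝ d)).toSphere univ ≤
      (volume : Measure (EuclideanSpace ℝ d)).toSphere ((↑) ⁻¹' P.allowed γ t i j)

omit [TopologicalSpace X] in
/-- **Causality (strict)**: the sets assigned at time `t` depend on the trajectory only through
its STRICT past `γ|_{(-∞, t)}` — the value `γ t` is the outcome of the decision taken at `t` (the
post-jump state), so a policy allowed to read `γ t` (or more of the future) could read off the
realised normal and void the freedom constraint (a "clairvoyant" policy of full freedom pins the
normal). The pre-collision state `z⁻ = lim_{s → t⁻} γ s` IS a function of the strict past. [folklore] -/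
def IsCausal (P : ControlPolicy d X N) : Prop :=
  ∀ γ γ' : ℝ → Config N d X, ∀ t, (∀ s < t, γ s = γ' s) → ∀ i j, P.allowed γ t i j = P.allowed γ' t i j

/-- **Well-posedness (freedom is counted among live normals)**: at any pre-collision state `z⁻`
of `γ` at `t` (a left limit, in contact and incoming for `(i, j)`), EVERY unit normal the policy
allows makes the pair outgoing after the reflection, so that each adversary choice can be honoured
by a controlled jump (`not_isOutgoing_collidePairWith_of_dead`: about half of the sphere is dead
and could otherwise be used to pad the assigned sets). [folklore] -/
def WellPosed (P : ControlPolicy d X N) (G : Geometry d X) (ε : ℝ) : Prop :=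
  ∀ (γ : ℝ → Config N d X) (t : ℝ) (i j : Fin N), i ≠ j → ∀ zl : Config N d X, Tendsto γ (𝓝[<] t) (𝓝 zl) →
    zl ∈ contactSet G N ε i j → IsIncoming G zl i j →
      ∀ n ∈ P.allowed γ t i j, ‖n‖ = 1 → IsOutgoing G (collidePairWith i j n zl) i j

/-- **Admissibility**: `γ` with realised normals `ν` is a controlled hard-sphere trajectory and at
every contact time of every (ordered) contact pair the realised normal lies in the assigned set. [folklore] -/
def Admissible (P : ControlPolicy d X N) (G : Geometry d X) (ε : ℝ) (γ : ℝ → Config N d X)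
    (ν : ℝ → EuclideanSpace ℝ d) : Prop :=
  IsControlledHardSphereTrajectory G ε N γ ν ∧
    ∀ t (i j : Fin N), i ≠ j → γ t ∈ contactSet G N ε i j → ν t ∈ P.allowed γ t i j

/-- An admissible pair is a controlled trajectory. [folklore] -/
theorem Admissible.isControlled {P : ControlPolicy d X N} {G : Geometry d X} {ε : ℝ}
    {γ : ℝ → Config N d X} {ν : ℝ → EuclideanSpace ℝ d} (h : P.Admissible G ε γ ν) :
    IsControlledHardSphereTrajectory G ε N γ ν :=
  h.1

/-- **The reachable set** `Reach P G ε t z₀ = {γ t | (γ, ν) admissible for P, γ 0 = z₀}`. [folklore] -/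
def Reach (P : ControlPolicy d X N) (G : Geometry d X) (ε : ℝ) (t : ℝ) (z₀ : Config N d X) :
    Set (Config N d X) :=
  {z | ∃ (γ : ℝ → Config N d X) (ν : ℝ → EuclideanSpace ℝ d), P.Admissible G ε γ ν ∧ γ 0 = z₀ ∧ γ t = z}

/-- **Robust steering**: the policy `P` steers `z₀` into `B` at time `t` if some admissible
trajectory starts at `z₀` and EVERY admissible trajectory from `z₀` is in `B` at time `t` (the
form consumed when an adversary/randomness picks the normal inside the assigned sets; meaningful
for strictly causal, well-posed policies, `IsCausal`, `WellPosed`, as in `SteerableWithFreedom`: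
the jump itself can honour every adversary choice; adversary choices after which the LATER motion
leaves the class — a subsequent multiple or grazing contact, codimension-one events — produce no
admissible trajectory and are absent from the quantifier). [folklore] -/
def Steers (P : ControlPolicy d X N) (G : Geometry d X) (ε : ℝ) (t : ℝ) (z₀ : Config N d X)
    (B : Set (Config N d X)) : Prop :=
  (P.Reach G ε t z₀).Nonempty ∧ P.Reach G ε t z₀ ⊆ B

/-- Membership in the reachable set. [folklore] -/
theorem mem_reach_iff {P : ControlPolicy d X N} {G : Geometry d X} {ε t : ℝ} {z₀ z : Config N d X} :
    z ∈ P.Reach G ε t z₀ ↔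
      ∃ (γ : ℝ → Config N d X) (ν : ℝ → EuclideanSpace ℝ d), P.Admissible G ε γ ν ∧ γ 0 = z₀ ∧ γ t = z :=
  Iff.rfl

/-- Enlarging the assigned sets enlarges the reachable set. [folklore] -/
theorem reach_mono {P Q : ControlPolicy d X N} (hPQ : ∀ γ t i j, P.allowed γ t i j ⊆ Q.allowed γ t i j)
    (G : Geometry d X) (ε t : ℝ) (z₀ : Config N d X) : P.Reach G ε t z₀ ⊆ Q.Reach G ε t z₀ := by
  rintro z ⟨γ, ν, ⟨hc, ha⟩, h0, ht⟩
  exact ⟨γ, ν, ⟨hc, fun s i j hij hs => hPQ _ _ _ _ (ha s i j hij hs)⟩, h0, ht⟩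

end ControlPolicy

namespace ControlPolicy

omit [TopologicalSpace X] in
/-- **The unconstrained policy**: every normal is allowed everywhere. [folklore] -/
def univPolicy : ControlPolicy d X N := ⟨fun _ _ _ _ => univ⟩

omit [TopologicalSpace X] in
/-- The unconstrained policy has every freedom `η ≤ 1` — so freedom is NO constraint on what a
single admissible trajectory can do. [folklore] -/
theorem univPolicy_hasFreedom {η : ℝ} (hη : η ≤ 1) : (univPolicy : ControlPolicy d X N).HasFreedom η := by
  intro γ t i j
  simp only [univPolicy, preimage_univ]
  exact ⟨MeasurableSet.univ, mul_le_of_le_one_left bot_le (ENNReal.ofReal_le_one.2 hη)⟩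

omit [Fintype d] [TopologicalSpace X] in
/-- The unconstrained policy is (trivially) causal. [folklore] -/
theorem univPolicy_isCausal : (univPolicy : ControlPolicy d X N).IsCausal :=
  fun _ _ _ _ _ _ => rfl

/-- **Existential reachability is freedom-blind**: every policy's reachable set lies in that of
the unconstrained policy (which has every freedom `η ≤ 1`). Hence a statement of the form
"`B` meets `P.Reach …` for some policy `P` of freedom `η`" does not depend on `η`; route
statements about `η`-freedom control (LaneReachability) must use the robust form
`SteerableWithFreedom` below. [folklore] -/
theorem reach_subset_reach_univPolicy (P : ControlPolicy d X N) (G : Geometry d X) (ε t : ℝ) (z₀ : Config N d X) :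
    P.Reach G ε t z₀ ⊆ (univPolicy : ControlPolicy d X N).Reach G ε t z₀ :=
  reach_mono (fun _ _ _ _ => subset_univ _) G ε t z₀

omit [TopologicalSpace X] in
/-- **Small interventions** (the "cap around `ω`" of Ott–Grebogi–Yorke-type control): every
allowed unit normal at a contact of `(i, j)` makes an angle at most `θ` with the contact LINE
`ℝ(x_i - x_j)` of `γ t`, `cos θ ≤ |⟪n, ε⁻¹(x_i - x_j)⟫|`. An optional smallness hypothesis on a
policy (the freedom `η` must then be small enough for caps of aperture `θ` to have normalised
measure `≥ η`). [folklore] -/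
def InCap (P : ControlPolicy d X N) (G : Geometry d X) (ε θ : ℝ) : Prop :=
  ∀ γ t (i j : Fin N), i ≠ j → γ t ∈ contactSet G N ε i j → ∀ n ∈ P.allowed γ t i j, ‖n‖ = 1 →
    Real.cos θ ≤ |⟪n, ε⁻¹ • G.sepVec ((γ t) i).1 ((γ t) j).1⟫_ℝ|

end ControlPolicy

/-- **`η`-freedom steerability** (the robust notion consumed by reachability statements): `z₀`
can be steered into the target set `B` at time `t` with freedom `η` if SOME STRICTLY CAUSAL,
WELL-POSED policy of freedom `η` steers it there — some admissible trajectory from `z₀` exists and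
EVERY trajectory admissible for that policy starting at `z₀` lies in `B` at time `t`, whatever
normals the adversary realises inside the assigned sets (each of normalised measure `≥ η`,
consisting of LIVE normals only, `WellPosed`, and fixed by the pre-collision history only,
`IsCausal`). Antitone in `η`, monotone in `B`. [folklore] -/
def SteerableWithFreedom (G : Geometry d X) (ε : ℝ) (N : ℕ) (η t : ℝ) (z₀ : Config N d X)
    (B : Set (Config N d X)) : Prop :=
  ∃ P : ControlPolicy d X N, P.IsCausal ∧ P.WellPosed G ε ∧ P.HasFreedom η ∧ P.Steers G ε t z₀ B

/-- Less freedom demanded of the policy, easier to steer: `SteerableWithFreedom` is antitone in `η`. [folklore] -/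
theorem SteerableWithFreedom.anti {G : Geometry d X} {ε η η' t : ℝ} {z₀ : Config N d X} {B : Set (Config N d X)}
    (hη : η ≤ η') (h : SteerableWithFreedom G ε N η' t z₀ B) : SteerableWithFreedom G ε N η t z₀ B := by
  obtain ⟨P, hc, hw, hP, hst⟩ := h
  refine ⟨P, hc, hw, fun γ s i j => ⟨(hP γ s i j).1, le_trans ?_ (hP γ s i j).2⟩, hst⟩
  gcongr

/-- A larger target is easier to reach: `SteerableWithFreedom` is monotone in `B`. [folklore] -/
theorem SteerableWithFreedom.mono {G : Geometry d X} {ε η t : ℝ} {z₀ : Config N d X} {B B' : Set (Config N d X)}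
    (hB : B ⊆ B') (h : SteerableWithFreedom G ε N η t z₀ B) : SteerableWithFreedom G ε N η t z₀ B' := by
  obtain ⟨P, hc, hw, hP, hne, hsub⟩ := h
  exact ⟨P, hc, hw, hP, hne, hsub.trans hB⟩

/-! ## Sanity: the true policy gives back the uncontrolled dynamics -/

/-- **The true policy**: at a contact of `(i, j)` at time `t` the only admissible normals are the
unit contact normals `±(x_i⁻ - x_j⁻)/ε` of the PRE-collision positions
`x_k⁻ = lim_{s → t⁻} x_k(s)` (`limUnder (𝓝[<] t)`, so that the policy is strictly causal,
`truePolicy_isCausal`; along a curve with continuous positions these are the positions of `γ t`,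
`truePolicy_allowed_eq`). A two-point set on the sphere: no positive freedom is to be expected of
it (not proved here). [folklore] -/
def truePolicy (G : Geometry d X) (ε : ℝ) : ControlPolicy d X N where
  allowed γ t i j :=
    haveI : Nonempty X := ⟨(γ t i).1⟩
    {n | n = ε⁻¹ • G.sepVec (limUnder (𝓝[<] t) fun s => (γ s i).1) (limUnder (𝓝[<] t) fun s => (γ s j).1) ∨
      n = -(ε⁻¹ • G.sepVec (limUnder (𝓝[<] t) fun s => (γ s i).1) (limUnder (𝓝[<] t) fun s => (γ s j).1))}

/-- **The true policy is strictly causal**: the pre-collision positions depend on `γ|_{(-∞, t)}`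
only (`limUnder` of a filter on `(-∞, t)`). [folklore] -/
theorem truePolicy_isCausal (G : Geometry d X) (ε : ℝ) : (truePolicy G ε : ControlPolicy d X N).IsCausal := by
  intro γ γ' t hγ i j
  haveI : Nonempty X := ⟨(γ t i).1⟩
  have hlim : ∀ k : Fin N, limUnder (𝓝[<] t) (fun s => (γ s k).1) = limUnder (𝓝[<] t) (fun s => (γ' s k).1) := by
    intro k
    have h : (fun s => (γ s k).1) =ᶠ[𝓝[<] t] fun s => (γ' s k).1 :=
      eventually_nhdsWithin_of_forall fun s hs => by
        show (γ s k).1 = (γ' s k).1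
        rw [hγ s hs]
    unfold limUnder
    rw [Filter.map_congr h]
  simp only [truePolicy]
  rw [hlim i, hlim j]

/-- Along a curve with continuous positions (Hausdorff position space) the true policy allows
exactly `±ε⁻¹ (x_i(t) - x_j(t))`. [folklore] -/
theorem truePolicy_allowed_eq [T2Space X] (G : Geometry d X) (ε : ℝ) {γ : ℝ → Config N d X}
    (hγ : ∀ i, Continuous fun s => (γ s i).1) (t : ℝ) (i j : Fin N) :
    (truePolicy G ε : ControlPolicy d X N).allowed γ t i j =
      {n | n = ε⁻¹ • G.sepVec ((γ t) i).1 ((γ t) j).1 ∨ n = -(ε⁻¹ • G.sepVec ((γ t) i).1 ((γ t) j).1)} := by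
  have hlim : ∀ k : Fin N, @limUnder X _ ℝ ⟨(γ t k).1⟩ (𝓝[<] t) (fun s => (γ s k).1) = (γ t k).1 :=
    fun k => (((hγ k).tendsto t).mono_left nhdsWithin_le_nhds).limUnder_eq
  simp only [truePolicy]
  rw [hlim i, hlim j]

/-- Along any curve with a left limit `z⁻` at `t` (Hausdorff position space) the true policy allows
exactly `±ε⁻¹ (x_i⁻ - x_j⁻)`. [folklore] -/
theorem truePolicy_allowed_eq_of_tendsto [T2Space X] (G : Geometry d X) (ε : ℝ) {γ : ℝ → Config N d X}
    {t : ℝ} {zl : Config N d X} (hzl : Tendsto γ (𝓝[<] t) (𝓝 zl)) (i j : Fin N) :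
    (truePolicy G ε : ControlPolicy d X N).allowed γ t i j =
      {n | n = ε⁻¹ • G.sepVec (zl i).1 (zl j).1 ∨ n = -(ε⁻¹ • G.sepVec (zl i).1 (zl j).1)} := by
  have hlim : ∀ k : Fin N, @limUnder X _ ℝ ⟨(γ t k).1⟩ (𝓝[<] t) (fun s => (γ s k).1) = (zl k).1 := by
    intro k
    have hc : Continuous fun z : Config N d X => (z k).1 := continuous_fst.comp (continuous_apply k)
    have h1 : Tendsto (fun s => (γ s k).1) (𝓝[<] t) (𝓝 (zl k).1) := (hc.tendsto zl).comp hzl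
    exact h1.limUnder_eq
  simp only [truePolicy]
  rw [hlim i, hlim j]

/-- **The true policy is well posed**: the true reflection of an incoming pair is outgoing
(`isOutgoing_collidePair_iff`). [folklore] -/
theorem truePolicy_wellPosed [T2Space X] (G : Geometry d X) {ε : ℝ} (hε : ε ≠ 0) :
    (truePolicy G ε : ControlPolicy d X N).WellPosed G ε := by
  intro γ t i j hij zl hzl _ hin n hn _
  rw [truePolicy_allowed_eq_of_tendsto G ε hzl] at hn
  rw [collidePairWith_eq_collidePair_of_mem_truePolicy hε hn]
  exact (isOutgoing_collidePair_iff hij zl).2 hin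

/-- Positions do not jump: along a controlled trajectory the left limit at `t` has the positions
of `γ t`. [folklore] -/
theorem IsControlledHardSphereTrajectory.tendsto_fst [T2Space X] {G : Geometry d X} {ε : ℝ}
    {γ : ℝ → Config N d X} {ν : ℝ → EuclideanSpace ℝ d} (h : IsControlledHardSphereTrajectory G ε N γ ν)
    {t : ℝ} {zl : Config N d X} (hzl : Tendsto γ (𝓝[<] t) (𝓝 zl)) (i : Fin N) : (zl i).1 = (γ t i).1 := by
  have hc : Continuous fun z : Config N d X => (z i).1 := continuous_fst.comp (continuous_apply i)
  have h1 : Tendsto (fun s => (γ s i).1) (𝓝[<] t) (𝓝 (zl i).1) := (hc.tendsto zl).comp hzl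
  have h2 : Tendsto (fun s => (γ s i).1) (𝓝[<] t) (𝓝 (γ t i).1) :=
    ((h.pos_continuous i).tendsto t).mono_left nhdsWithin_le_nhds
  exact tendsto_nhds_unique h1 h2

/-- **Admissible for the true policy ⇒ hard-sphere trajectory** (`ε ≠ 0`, Hausdorff position
space so that left limits carry the positions of `γ t`). [folklore] -/
theorem ControlPolicy.Admissible.isHardSphereTrajectory [T2Space X] {G : Geometry d X} {ε : ℝ} (hε : ε ≠ 0)
    {γ : ℝ → Config N d X} {ν : ℝ → EuclideanSpace ℝ d} (h : (truePolicy G ε).Admissible G ε γ ν) :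
    IsHardSphereTrajectory G ε N γ where
  mem := h.1.mem
  locFinite := h.1.locFinite
  pos_continuous := h.1.pos_continuous
  free := h.1.free
  binary t i j hij ht := by
    obtain ⟨huniq, zl, hzl, hin, -, hjump, -⟩ := h.1.binary t i j hij ht
    refine ⟨huniq, zl, hzl, hin, ?_⟩
    have hn := h.2 t i j hij ht
    rw [truePolicy_allowed_eq G ε h.1.pos_continuous] at hn
    simp only [mem_setOf_eq] at hn
    rw [← h.1.tendsto_fst hzl i, ← h.1.tendsto_fst hzl j] at hn
    rw [hjump, collidePairWith_eq_collidePair_of_mem_truePolicy hε hn]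

omit [TopologicalSpace X] in
open Classical in
/-- **The realised normals of an (uncontrolled) hard-sphere trajectory**: at a contact time, the
unit contact normal `ε⁻¹ (x_i - x_j)` of some contact pair (chosen; by `binary` the pair is unique
up to order); `0` elsewhere. [folklore] -/
def trueNormal (G : Geometry d X) (ε : ℝ) (γ : ℝ → Config N d X) (t : ℝ) : EuclideanSpace ℝ d :=
  if h : ∃ p : Fin N × Fin N, p.1 ≠ p.2 ∧ γ t ∈ contactSet G N ε p.1 p.2 then
    ε⁻¹ • G.sepVec ((γ t) (Classical.choose h).1).1 ((γ t) (Classical.choose h).2).1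
  else 0

/-- Along a hard-sphere trajectory, at a contact time of `(i, j)` the realised normal is
`±ε⁻¹ (x_i - x_j)` (antisymmetric separation map, as for `Euclidean.geometry` and
`Torus.geometry`). [folklore] -/
theorem IsHardSphereTrajectory.trueNormal_eq_or {G : Geometry d X} (hG : ∀ x y : X, G.sepVec y x = -G.sepVec x y)
    {ε : ℝ} {γ : ℝ → Config N d X} (h : IsHardSphereTrajectory G ε N γ) {t : ℝ} {i j : Fin N} (hij : i ≠ j)
    (ht : γ t ∈ contactSet G N ε i j) :
    trueNormal G ε γ t = ε⁻¹ • G.sepVec ((γ t) i).1 ((γ t) j).1 ∨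
      trueNormal G ε γ t = -(ε⁻¹ • G.sepVec ((γ t) i).1 ((γ t) j).1) := by
  classical
  have h' : ∃ p : Fin N × Fin N, p.1 ≠ p.2 ∧ γ t ∈ contactSet G N ε p.1 p.2 := ⟨(i, j), hij, ht⟩
  obtain ⟨hne, hmem⟩ := Classical.choose_spec h'
  have hpair := (h.binary t i j hij ht).1 _ _ hne hmem
  have h1 : (Classical.choose h').1 ∈ ({i, j} : Finset (Fin N)) := by rw [← hpair]; simp
  have h2 : (Classical.choose h').2 ∈ ({i, j} : Finset (Fin N)) := by rw [← hpair]; simp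
  simp only [Finset.mem_insert, Finset.mem_singleton] at h1 h2
  simp only [trueNormal, dif_pos h']
  rcases h1 with h1 | h1 <;> rcases h2 with h2 | h2
  · exact absurd (h1.trans h2.symm) hne
  · left; rw [h1, h2]
  · right; rw [h1, h2, hG, smul_neg]
  · exact absurd (h1.trans h2.symm) hne

/-- **Hard-sphere trajectory ⇒ admissible for the true policy** with the realised normals
`trueNormal` (`0 < ε`, antisymmetric separation map, Hausdorff position space); with
`Admissible.isHardSphereTrajectory` this says that the true policy gives back exactly the
uncontrolled hard-sphere dynamics. [folklore] -/
theorem IsHardSphereTrajectory.admissible_truePolicy [T2Space X] {G : Geometry d X}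
    (hG : ∀ x y : X, G.sepVec y x = -G.sepVec x y) {ε : ℝ} (hε : 0 < ε) {γ : ℝ → Config N d X}
    (h : IsHardSphereTrajectory G ε N γ) : (truePolicy G ε).Admissible G ε γ (trueNormal G ε γ) := by
  have hpos : ∀ t (i : Fin N) (zl : Config N d X), Tendsto γ (𝓝[<] t) (𝓝 zl) → (zl i).1 = (γ t i).1 := by
    intro t i zl hzl
    have hc : Continuous fun z : Config N d X => (z i).1 := continuous_fst.comp (continuous_apply i)
    have h1 : Tendsto (fun s => (γ s i).1) (𝓝[<] t) (𝓝 (zl i).1) := (hc.tendsto zl).comp hzl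
    exact tendsto_nhds_unique h1 (((h.pos_continuous i).tendsto t).mono_left nhdsWithin_le_nhds)
  refine ⟨⟨h.mem, h.locFinite, h.pos_continuous, h.free, fun t i j hij ht => ?_⟩,
    fun t i j hij ht => by
      rw [truePolicy_allowed_eq G ε h.pos_continuous]
      exact h.trueNormal_eq_or hG hij ht⟩
  obtain ⟨huniq, zl, hzl, hin, hjump⟩ := h.binary t i j hij ht
  have hn := h.trueNormal_eq_or hG hij ht
  refine ⟨huniq, zl, hzl, hin, ?_, ?_, hjump ▸ (isOutgoing_collidePair_iff hij zl).2 hin⟩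
  · have hnorm : ‖ε⁻¹ • G.sepVec ((γ t) i).1 ((γ t) j).1‖ = 1 := by
      rw [norm_smul, norm_inv, Real.norm_eq_abs, abs_of_pos hε, ht.2, inv_mul_cancel₀ hε.ne']
    rcases hn with hn | hn
    · rw [hn, hnorm]
    · rw [hn, norm_neg, hnorm]
  · rw [← hpos t i zl hzl, ← hpos t j zl hzl] at hn
    rw [collidePairWith_eq_collidePair_of_mem_truePolicy hε.ne' hn, hjump]

/-- **The true policy gives back the hard-sphere dynamics**: `γ` is a hard-sphere trajectory iff
it is admissible for the true policy with some realised normals. [folklore] -/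
theorem isHardSphereTrajectory_iff_exists_admissible_truePolicy [T2Space X] {G : Geometry d X}
    (hG : ∀ x y : X, G.sepVec y x = -G.sepVec x y) {ε : ℝ} (hε : 0 < ε) {γ : ℝ → Config N d X} :
    IsHardSphereTrajectory G ε N γ ↔ ∃ ν, (truePolicy G ε).Admissible G ε γ ν :=
  ⟨fun h => ⟨_, h.admissible_truePolicy hG hε⟩, fun ⟨_, h⟩ => h.isHardSphereTrajectory hε.ne'⟩

/-- **Energy is conserved at every controlled jump**: along a controlled trajectory, at a contact
time the kinetic energy of `γ t` equals that of the left limit. [folklore] -/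
theorem IsControlledHardSphereTrajectory.configEnergy_eq_of_tendsto [T2Space X] {G : Geometry d X} {ε : ℝ}
    {γ : ℝ → Config N d X} {ν : ℝ → EuclideanSpace ℝ d} (h : IsControlledHardSphereTrajectory G ε N γ ν)
    {t : ℝ} {i j : Fin N} (hij : i ≠ j) (ht : γ t ∈ contactSet G N ε i j) {zl : Config N d X}
    (hzl : Tendsto γ (𝓝[<] t) (𝓝 zl)) : configEnergy (γ t) = configEnergy zl := by
  obtain ⟨-, zl', hzl', -, -, hjump, -⟩ := h.binary t i j hij ht
  have : zl' = zl := tendsto_nhds_unique hzl' hzl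
  subst this
  rw [hjump, configEnergy_collidePairWith hij]

/-- **Momentum is conserved at every controlled jump.** [folklore] -/
theorem IsControlledHardSphereTrajectory.configMomentum_eq_of_tendsto [T2Space X] {G : Geometry d X} {ε : ℝ}
    {γ : ℝ → Config N d X} {ν : ℝ → EuclideanSpace ℝ d} (h : IsControlledHardSphereTrajectory G ε N γ ν)
    {t : ℝ} {i j : Fin N} (hij : i ≠ j) (ht : γ t ∈ contactSet G N ε i j) {zl : Config N d X}
    (hzl : Tendsto γ (𝓝[<] t) (𝓝 zl)) : configMomentum (γ t) = configMomentum zl := by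
  obtain ⟨-, zl', hzl', -, -, hjump, -⟩ := h.binary t i j hij ht
  have : zl' = zl := tendsto_nhds_unique hzl' hzl
  subst this
  rw [hjump, configMomentum_collidePairWith hij]

end Trajectory

end Kinetic

end

end Literature.Analysis.FluidPDE
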